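import Summits.Ventures.PercRepro2.CaseOneTwoMarkRed
import Summits.Ventures.PercRepro2.CaseOneTwoMarkClose

/-!
# `a₃` adjacent exactly to `o` and `b`: the facts of the base law as a bundle
(blind cell PercRepro2, p1 g15; S5 §2.1 (K9) (o), proofs/P1-TWOMARK.md §7)

`TMFacts m`: the three relations between the twelve base masses, the nine CELL nonnegativities
(`m_xy = P₀(Q₀, o-status x, b-status y)` written as differences of the base masses) and the twelve
pairwise atoms (BHK 1.3 on `C₂` / `C₁`, BHK 1.4 in both orders, BHK 1.4 with one cluster avoiding one
mark (four), the odds lemma and the Q-pair odds condition at `b` and at `o`); `tmFacts`: they all hold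
at `tmMasses p ends o a₁ a₂ b` for every product law `p`. Every cell certificate of the two-mark class
(`(ii)`: CaseOneTwoMarkClose.lean; `(i)`: CaseOneTwoMarkCertI*.lean) is a `linarith` over these facts. -/

namespace Summit.Ventures.PercRepro2

namespace CaseOne

/-! ## The facts of the base law: relations, cells, atoms -/

section Facts
variable {R : Type*} [CommRing R] [LinearOrder R] [IsStrictOrderedRing R]

/-- The facts used by every cell certificate of the two-mark class: the three relations, the nine
cell nonnegativities (`m_xy = P₀(Q₀, o-status x, b-status y)` as differences of the base masses) and
the twelve pairwise atoms (BHK 1.3 on `C₂` / `C₁`, BHK 1.4 in both orders, BHK 1.4 with one cluster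
avoiding one mark (four), the odds lemma and the Q-pair odds condition at `b` and at `o`). -/
structure TMFacts (m : TMMasses R) : Prop where
  /-- `oU = o₁ + o₂` -/
  hoU : m.oU = m.o₁ + m.o₂
  /-- `bU = b₁ + b` -/
  hbU : m.bU = m.b₁ + m.b
  /-- `oUbU = ob + bo₁ + ob₁ + o₁b₁` -/
  hoUbU : m.oUbU = m.ob + m.bo₁ + m.ob₁ + m.o₁b₁
  /-- the cell `(1,1)` -/
  hc11 : 0 ≤ m.o₁b₁
  /-- the cell `(1,2)` -/
  hc12 : 0 ≤ m.bo₁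
  /-- the cell `(1,N)` -/
  hc1N : 0 ≤ m.o₁ - m.o₁b₁ - m.bo₁
  /-- the cell `(2,1)` -/
  hc21 : 0 ≤ m.ob₁
  /-- the cell `(2,2)` -/
  hc22 : 0 ≤ m.ob
  /-- the cell `(2,N)` -/
  hc2N : 0 ≤ m.o₂ - m.ob₁ - m.ob
  /-- the cell `(N,1)` -/
  hcN1 : 0 ≤ m.b₁ - m.o₁b₁ - m.ob₁
  /-- the cell `(N,2)` -/
  hcN2 : 0 ≤ m.b - m.ob - m.bo₁
  /-- the cell `(N,N)` -/
  hcNN : 0 ≤ m.M - m.oU - m.bU + m.oUbU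
  /-- BHK 1.3 on `C₂` (H13C2) -/
  hA1 : m.b * m.o₂ ≤ m.ob * m.M
  /-- BHK 1.3 on `C₁` (H13C1) -/
  hA1' : m.o₁ * m.b₁ ≤ m.o₁b₁ * m.M
  /-- BHK 1.4, `b ∈ C₂` against `o ∈ C₁` (H14bo) -/
  hA2 : m.M * m.bo₁ ≤ m.b * m.o₁
  /-- BHK 1.4, `o ∈ C₂` against `b ∈ C₁` (H14ob) -/
  hA3 : m.M * m.ob₁ ≤ m.o₂ * m.b₁
  /-- BHK 1.4 with `C₁` avoiding `{a₂, o}` (H14mav_o) -/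
  hA4 : m.ob₁ * (m.M - m.o₁) ≤ (m.b₁ - m.o₁b₁) * m.o₂
  /-- BHK 1.4 with `C₁` avoiding `{a₂, b}` (H14mav_b) -/
  hA4' : m.bo₁ * (m.M - m.b₁) ≤ (m.o₁ - m.o₁b₁) * m.b
  /-- the Q-pair odds condition at `b` (oddsQ_b) -/
  hA5 : m.M * m.ob₁ ≤ m.b₁ * m.oU
  /-- the Q-pair odds condition at `o` (oddsQ_o) -/
  hA5' : m.M * m.bo₁ ≤ m.o₁ * m.bU
  /-- the odds lemma at `b` (odds_b) -/
  hA6 : (m.M - m.bU) * m.ob₁ ≤ (m.oU - m.oUbU) * m.b₁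
  /-- the odds lemma at `o` (odds_o) -/
  hA6' : (m.M - m.oU) * m.bo₁ ≤ (m.bU - m.oUbU) * m.o₁
  /-- BHK 1.4 with `C₂` avoiding `{a₁, o}` (H14av_o) -/
  hA7 : m.bo₁ * (m.M - m.o₂) ≤ (m.b - m.ob) * m.o₁
  /-- BHK 1.4 with `C₂` avoiding `{a₁, b}` (H14av_b) -/
  hA7' : m.ob₁ * (m.M - m.b) ≤ (m.o₂ - m.ob) * m.b₁

end Facts

section FactsProof
variable {V : Type*} {E : Type*} [Fintype E] [DecidableEq E] [Fintype V] [DecidableEq V]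
  {R : Type*} [Field R] [LinearOrder R] [IsStrictOrderedRing R]

/-- **The odds lemma at `o`** (atom odds_o, the mirror of `tm_odds_b`):
`(P(Q₀) − P(Q₀, o ∈ U)) · P(Q₀, O₁, B₂) ≤ (P(Q₀, b ∈ U) − P(Q₀, o ∈ U, b ∈ U)) · P(Q₀, O₁)`. -/
lemma tm_odds_o (p : E → R) (hp : IsProbVec p) (ends : E → Sym2 V) (o a₁ a₂ b : V) :
    (prob p (connEvent ends a₁ a₂)ᶜ -
          prob p ((connEvent ends a₁ a₂)ᶜ ∩ (connEvent ends a₁ o ∪ connEvent ends a₂ o))) *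
        prob p ((connEvent ends a₁ a₂)ᶜ ∩ connEvent ends a₁ o ∩ connEvent ends a₂ b) ≤
      (prob p ((connEvent ends a₁ a₂)ᶜ ∩ (connEvent ends a₁ b ∪ connEvent ends a₂ b)) -
          prob p ((connEvent ends a₁ a₂)ᶜ ∩ (connEvent ends a₁ o ∪ connEvent ends a₂ o) ∩
            (connEvent ends a₁ b ∪ connEvent ends a₂ b))) *
        prob p ((connEvent ends a₁ a₂)ᶜ ∩ connEvent ends a₁ o) := by
  have h := tm_odds_b p hp ends b a₁ a₂ o
  have e : (connEvent ends a₁ a₂)ᶜ ∩ (connEvent ends a₁ b ∪ connEvent ends a₂ b) ∩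
      (connEvent ends a₁ o ∪ connEvent ends a₂ o) =
      (connEvent ends a₁ a₂)ᶜ ∩ (connEvent ends a₁ o ∪ connEvent ends a₂ o) ∩
        (connEvent ends a₁ b ∪ connEvent ends a₂ b) := Set.inter_right_comm _ _ _
  rw [prob_congr_set p e] at h
  exact h

/-- **All the facts hold at every product law**: the relations, the nine cells and the twelve atoms
at `tmMasses p ends o a₁ a₂ b`. -/
theorem tmFacts (p : E → R) (hp : IsProbVec p) (ends : E → Sym2 V) (o a₁ a₂ b : V) :
    TMFacts (tmMasses p ends o a₁ a₂ b) := by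
  set m := tmMasses p ends o a₁ a₂ b with hm
  -- a generic cell: `P(Q₀ ∩ X) − P(Q₀ ∩ X ∩ {a₁ ↔ y}) − P(Q₀ ∩ X ∩ {a₂ ↔ y}) ≥ 0`
  have cell : ∀ (X : Set (E → Bool)) (y : V),
      0 ≤ prob p ((connEvent ends a₁ a₂)ᶜ ∩ X) -
        prob p ((connEvent ends a₁ a₂)ᶜ ∩ X ∩ connEvent ends a₁ y) -
        prob p ((connEvent ends a₁ a₂)ᶜ ∩ X ∩ connEvent ends a₂ y) := by
    intro X y
    have s1 := prob_inter_add_prob_inter_compl p ((connEvent ends a₁ a₂)ᶜ ∩ X)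
      (connEvent ends a₁ y ∪ connEvent ends a₂ y)
    have h0 := prob_nonneg hp ((connEvent ends a₁ a₂)ᶜ ∩ X ∩
      (connEvent ends a₁ y ∪ connEvent ends a₂ y)ᶜ)
    have e : (connEvent ends a₁ a₂)ᶜ ∩ X ∩ (connEvent ends a₁ y ∪ connEvent ends a₂ y) =
        ((connEvent ends a₁ a₂)ᶜ ∩ X ∩ connEvent ends a₁ y) ∪
          ((connEvent ends a₁ a₂)ᶜ ∩ X ∩ connEvent ends a₂ y) := by
      ext ω
      simp only [Set.mem_inter_iff, Set.mem_union, Set.mem_compl_iff]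
      tauto
    have d : Disjoint ((connEvent ends a₁ a₂)ᶜ ∩ X ∩ connEvent ends a₁ y)
        ((connEvent ends a₁ a₂)ᶜ ∩ X ∩ connEvent ends a₂ y) :=
      Set.disjoint_left.2 fun _ hω hω' => hω.1.1 (conn_trans hω.2 (conn_symm hω'.2))
    rw [e, prob_union_of_disjoint p d] at s1
    linarith [s1, h0]
  refine ⟨tmMasses_oU p a₁ a₂, tmMasses_bU p a₁ a₂, tmMasses_oUbU p a₁ a₂, prob_nonneg hp _,
    prob_nonneg hp _, cell (connEvent ends a₁ o) b, prob_nonneg hp _, prob_nonneg hp _, ?_, ?_, ?_, ?_,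
    tm_bhk_same_a2 p hp ends o a₁ a₂ b, tm_bhk_same_a1 p hp ends o a₁ a₂ b,
    tm_bhk_cross_o1_b2 p hp ends o a₁ a₂ b, tm_bhk_cross_b1_o2 p hp ends o a₁ a₂ b,
    tm_bhk_avoid_c1 p hp ends o a₁ a₂ b, ?_, tm_oddsQ_b p hp ends o a₁ a₂ b,
    tm_oddsQ_o p hp ends o a₁ a₂ b, tm_odds_b p hp ends o a₁ a₂ b, tm_odds_o p hp ends o a₁ a₂ b, ?_,
    tm_bhk_avoid_c2_b p hp ends o a₁ a₂ b⟩
  · -- (2,N)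
    have c := cell (connEvent ends a₂ o) b
    have e1 : (connEvent ends a₁ a₂)ᶜ ∩ connEvent ends a₂ o ∩ connEvent ends a₁ b =
        (connEvent ends a₁ a₂)ᶜ ∩ connEvent ends a₁ b ∩ connEvent ends a₂ o := Set.inter_right_comm _ _ _
    rw [prob_congr_set p e1] at c
    show 0 ≤ prob p _ - prob p _ - prob p _
    linarith [c]
  · -- (N,1)
    have c := cell (connEvent ends a₁ b) o
    have e1 : (connEvent ends a₁ a₂)ᶜ ∩ connEvent ends a₁ b ∩ connEvent ends a₁ o =
        (connEvent ends a₁ a₂)ᶜ ∩ connEvent ends a₁ o ∩ connEvent ends a₁ b := Set.inter_right_comm _ _ _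
    rw [prob_congr_set p e1] at c
    show 0 ≤ prob p _ - prob p _ - prob p _
    linarith [c]
  · -- (N,2)
    have c := cell (connEvent ends a₂ b) o
    have e1 : (connEvent ends a₁ a₂)ᶜ ∩ connEvent ends a₂ b ∩ connEvent ends a₁ o =
        (connEvent ends a₁ a₂)ᶜ ∩ connEvent ends a₁ o ∩ connEvent ends a₂ b := Set.inter_right_comm _ _ _
    have e2 : (connEvent ends a₁ a₂)ᶜ ∩ connEvent ends a₂ b ∩ connEvent ends a₂ o =
        (connEvent ends a₁ a₂)ᶜ ∩ connEvent ends a₂ o ∩ connEvent ends a₂ b := Set.inter_right_comm _ _ _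
    rw [prob_congr_set p e1, prob_congr_set p e2] at c
    show 0 ≤ prob p _ - prob p _ - prob p _
    linarith [c]
  · -- (N,N)
    have s1 := prob_inter_add_prob_inter_compl p (connEvent ends a₁ a₂)ᶜ
      (connEvent ends a₁ o ∪ connEvent ends a₂ o)
    have s2 := prob_inter_add_prob_inter_compl p
      ((connEvent ends a₁ a₂)ᶜ ∩ (connEvent ends a₁ o ∪ connEvent ends a₂ o)ᶜ)
      (connEvent ends a₁ b ∪ connEvent ends a₂ b)
    have s3 := prob_inter_add_prob_inter_compl p
      ((connEvent ends a₁ a₂)ᶜ ∩ (connEvent ends a₁ b ∪ connEvent ends a₂ b))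
      (connEvent ends a₁ o ∪ connEvent ends a₂ o)
    have h0 := prob_nonneg hp ((connEvent ends a₁ a₂)ᶜ ∩ (connEvent ends a₁ o ∪ connEvent ends a₂ o)ᶜ ∩
      (connEvent ends a₁ b ∪ connEvent ends a₂ b)ᶜ)
    have e1 : (connEvent ends a₁ a₂)ᶜ ∩ (connEvent ends a₁ b ∪ connEvent ends a₂ b) ∩
        (connEvent ends a₁ o ∪ connEvent ends a₂ o) =
        (connEvent ends a₁ a₂)ᶜ ∩ (connEvent ends a₁ o ∪ connEvent ends a₂ o) ∩
          (connEvent ends a₁ b ∪ connEvent ends a₂ b) := Set.inter_right_comm _ _ _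
    have e2 : (connEvent ends a₁ a₂)ᶜ ∩ (connEvent ends a₁ b ∪ connEvent ends a₂ b) ∩
        (connEvent ends a₁ o ∪ connEvent ends a₂ o)ᶜ =
        (connEvent ends a₁ a₂)ᶜ ∩ (connEvent ends a₁ o ∪ connEvent ends a₂ o)ᶜ ∩
          (connEvent ends a₁ b ∪ connEvent ends a₂ b) := Set.inter_right_comm _ _ _
    rw [e1, e2] at s3
    show 0 ≤ prob p _ - prob p _ - prob p _ + prob p _
    linarith [s1, s2, s3, h0]
  · -- H14mav_b
    have h' := tm_bhk_avoid_c1 p hp ends b a₁ a₂ o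
    have e : (connEvent ends a₁ a₂)ᶜ ∩ connEvent ends a₁ b ∩ connEvent ends a₁ o =
        (connEvent ends a₁ a₂)ᶜ ∩ connEvent ends a₁ o ∩ connEvent ends a₁ b := Set.inter_right_comm _ _ _
    rw [prob_congr_set p e] at h'
    exact h'
  · -- H14av_o
    have h' := tm_bhk_avoid_c1 p hp ends o a₂ a₁ b
    rw [connEvent_comm ends a₂ a₁] at h'
    have e : (connEvent ends a₁ a₂)ᶜ ∩ connEvent ends a₂ b ∩ connEvent ends a₁ o =
        (connEvent ends a₁ a₂)ᶜ ∩ connEvent ends a₁ o ∩ connEvent ends a₂ b := Set.inter_right_comm _ _ _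
    rw [prob_congr_set p e] at h'
    exact h'

end FactsProof

end CaseOne

end Summit.Ventures.PercRepro2
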